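import Summits.BirchSwinnertonDyer.BirchSwinnertonDyer.Theorems.GenusKolyvaginAtTwoOffCutResidualAtTwoRSocleSelectionTwistSelmerPair
import Summits.BirchSwinnertonDyer.BirchSwinnertonDyer.Theorems.GenusKolyvaginAtTwoGenusPrimitiveSupplyAtTwoPrimeTwistUnramifiedTwo
import Summits.BirchSwinnertonDyer.BirchSwinnertonDyer.Theorems.GenusKolyvaginAtTwoGenusPrimitiveSupplyAtTwoTranspositionTwistLaw
import Summits.BirchSwinnertonDyer.BirchSwinnertonDyer.Theorems.ByReductionTypeAtTwoRankOneAtTwoBigImageOddLocalOneDoorBottomLeavesLines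
import Summits.BirchSwinnertonDyer.BirchSwinnertonDyer.Theorems.GenusKolyvaginAtTwoEquivariantKolyvaginExactAtTwoPairBookkeeping
import HarnessLib

/-!
# Route `GenusKolyvaginAtTwo`, residual `OffCutResidualAtTwoR` (stmt-BirchSwinnertonDyer-31767), LINE 28 «visible_deep_socle» STUBS N1/N2 —
# THE TWIN'S SELMER COUNT ON A TRANSPOSITION-ADMISSIBLE FRAME IS DECIDED BY `ℓ₀`-NARROWNESS (`Δ < 0`): `#Sel₂(Wd) ∈ {#Sel₂(E)/2, 2·#Sel₂(E)}`

LEAD seat `bsd-line-gk2-p1` g25 (cell `bsd-f1-sign2`), `--supports stmt-BirchSwinnertonDyer-31767 --as helper`; companion of `…VisibleDeepSocleDoorTrivialLine` (the `ℓ₀`-trivial line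
is the twin's Selmer group) — independent of it.
THEOREMS ONLY (no definition, no named fact, no `sorry`).  **BSD is NOT proved by this file; `OffCutResidualAtTwoR`, K4Neg and crux 23491 are NOT proved; N1/N2
are NOT closed.**

WHAT.  `E/ℚ` globally minimal, `Δ_E < 0`; `(d, q₀)` transposition-admissible (`F1Sign2.TranspositionDoor.TranspAdmissible`), `v₀ ∋ q₀`; `Wd = Cd • E^{(d)}` any model.
Mazur–Rubin's one-place comparison (Prop. 3.3 at `T = {q₀}`; the tree's `natCard_selmerGroup_twist_directed_of_menu_frame` = Poitou–Tate + local Euler–Poincaré +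
gk2-p4's transposition place menu `transpAdmissible_place_menu`, with `#E(ℚ_{q₀})[2] = 2` at the transposition prime and `H¹(ℝ, ·) = 0` for `Δ < 0` on both sides)
read for an ARBITRARY `Sel₂(E)` (the tree's `transpositionTwistLawAtTwo_holds` is the rank-one, `#Sel₂(E) = 2` instance):

* §1 **`natCard_selmerGroup_twin_directed_of_transpAdmissible`** — if EVERY `2`-Selmer class of `E` is trivial at `v₀` then `#Sel₂(Wd) = 2·#Sel₂(E)`; if SOME
  `2`-Selmer class is non-trivial at `v₀` (`ℓ₀`-NARROW) then `2·#Sel₂(Wd) = #Sel₂(E)`.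
* §2 on a `#Sel₂(E) = 4` cell: **`natCard_selmerGroup_twin_eq_two_or_eq_eight`** (`#Sel₂(Wd) ∈ {2, 8}`) and
  **`natCard_selmerGroup_twin_eq_two_iff_exists_not_doorTrivial`** (`#Sel₂(Wd) = 2 ⟺ ℓ₀-narrow`), `natCard_selmerGroup_twin_eq_eight_iff_forall_doorTrivial`.
  READING for STUB N1 (`stub_visibleDeepSupply`): its output clause `#Sel₂(E^{(-ℓ₀)}) = 2` is EXACTLY «some `2`-Selmer class of `E` has `loc_{ℓ₀} ≠ 0`» — a
  Čebotarev condition on `ℓ₀` in the `(ℤ/2)²`-extension cut out by `Sel₂(E)` —, and its failure means `#Sel₂(E^{(-ℓ₀)}) = 8` with ALL of `Sel₂(E)` `ℓ₀`-trivial;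
  with `…VisibleDeepSocleSOC`'s `transpAdmissible_of_deepPrimeFrame` the hypothesis `TranspAdmissible` is free on every deep prime frame (`Δ < 0`, `2` split).
BSD is NOT proved by any of this.

References: [MazurRubin2010] Prop. 3.3, Lemma 2.10; [Kramer1981] Prop. 3, Thm. 1; [MilneADT2006] I.4.10, I.2.8.
-/

set_option autoImplicit false
-- the Theorems namespace of this sub repeats the summit name by design (D-0017 nested layout)
set_option linter.dupNamespace false

noncomputable section

open scoped Classical

namespace Summit.BirchSwinnertonDyer.BirchSwinnertonDyer.Theorems.GenusExact.PlusDescent.SocleSelection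

open WeierstrassCurve NumberField IsDedekindDomain Field
open Literature.NumberTheory.EllipticCurves Literature.NumberTheory.GaloisRepresentations
open Literature.NumberTheory.GaloisRepresentations.IsNonarchimedeanLocalField (maxUnramified)
open Summit.BirchSwinnertonDyer.Rank1Residual.F1Sign2.TranspositionDoor (TranspAdmissible)
open Summit.BirchSwinnertonDyer.BirchSwinnertonDyer.Theorems.GenusKolyTwistLocal (mem_torsionLocalKer_iff_localization_eq_zero_rat exists_intertwining_hsplit)
open Summit.BirchSwinnertonDyer.BirchSwinnertonDyer.Theorems.GenusKolyTwistRamified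
  (valuation_natCast_eq_exp_neg_one_of_mem closureEmb_geomSqrt_not_mem_maxUnramified_rat)
open Summit.BirchSwinnertonDyer.BirchSwinnertonDyer.Theorems.RankOneAtTwoOneDoor (natCard_ker_nsmul_adicCompletion_two_eq_two_of_jacobiSym)
open Summit.BirchSwinnertonDyer.BirchSwinnertonDyer.Theorems.GenusKolyTwistingPrime (primesEquiv_eq natCast_not_mem_of_not_dvd)
open Rat.HeightOneSpectrum (primesEquiv natGenerator)

variable (W : WeierstrassCurve ℚ) [W.IsElliptic] [W.IsGloballyMinimal] {d : ℤ} {q₀ : ℕ}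

/-! ## §1 The directed one-place comparison for an arbitrary `Sel₂(E)` -/

/-- **THE TWIN'S `2`-SELMER COUNT IS DECIDED BY `ℓ₀`-NARROWNESS** (`Δ_E < 0`, `(d, q₀)` transposition-admissible, `v₀ ∋ q₀`, `Wd = Cd • E^{(d)}`):
if every `2`-Selmer class of `E` is trivial at `v₀` then `#Sel₂(Wd) = 2·#Sel₂(E)`; if some `2`-Selmer class of `E` is non-trivial at `v₀` then
`2·#Sel₂(Wd) = #Sel₂(E)`.  Mazur–Rubin Prop. 3.3 at `T = {q₀}` (`dim H¹_f(ℚ_{q₀}, E[2]) = dim E(ℚ_{q₀})[2] = 1` at a transposition prime; the primes of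
`2N` and the silent primes of `d` are on the menu; no condition at `∞` for `Δ < 0`).  BSD is NOT proved by this.
[cite: MazurRubin2010, Prop. 3.3] [cite: Kramer1981, Prop. 3] [cite: MilneADT2006, I.4.10] -/
theorem natCard_selmerGroup_twin_directed_of_transpAdmissible (hΔ : W.Δ < 0) (hd : TranspAdmissible W d q₀)
    {v₀ : HeightOneSpectrum (𝓞 ℚ)} (hv₀ : (q₀ : 𝓞 ℚ) ∈ v₀.asIdeal)
    {Wd : WeierstrassCurve ℚ} [Wd.IsElliptic] (Cd : VariableChange ℚ) (hCd : Cd • W.quadraticTwist (d : ℚ) = Wd) :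
    ((∀ c ∈ W.selmerGroup ((2 : ℕ) : ℤ), c ∈ W.torsionLocalKer (v₀.adicCompletion ℚ) ((2 : ℕ) : ℤ)) →
        Nat.card (Wd.selmerGroup ((2 : ℕ) : ℤ)) = Nat.card (W.selmerGroup ((2 : ℕ) : ℤ)) * 2) ∧
    ((∃ c ∈ W.selmerGroup ((2 : ℕ) : ℤ), c ∉ W.torsionLocalKer (v₀.adicCompletion ℚ) ((2 : ℕ) : ℤ)) →
        Nat.card (Wd.selmerGroup ((2 : ℕ) : ℤ)) * 2 = Nat.card (W.selmerGroup ((2 : ℕ) : ℤ))) := by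
  have hd' := hd
  obtain ⟨hdneg, hsf, _, hq₀, hq₀d, hjac, hprimes, -⟩ := hd
  haveI : Fact q₀.Prime := ⟨hq₀⟩
  have hq₀2 : q₀ ≠ 2 := by
    rintro rfl
    have h2d : (2 : ℤ) ∣ d := by exact_mod_cast hq₀d
    omega
  have hn2 : ¬ q₀ ∣ 2 := fun h ↦ hq₀2 ((Nat.prime_dvd_prime_iff_eq hq₀ Nat.prime_two).mp h)
  have hgood₀ : W.HasGoodReductionAtPrime q₀ := (hprimes q₀ hq₀ hq₀d).1 inferInstance
  have hq₀Δ : ¬ (q₀ : ℤ) ∣ minimalDiscriminantInt W := W.not_dvd_minimalDiscriminantInt_of_hasGoodReductionAtPrime' _ hgood₀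
  have hq₀Δ' : ¬ (q₀ : ℤ) ∣ W.Δ.num := by rwa [← cast_minimalDiscriminantInt W, Rat.num_intCast]
  -- the `T`-place facts at `v₀`
  have h2v₀ : ((2 : ℕ) : 𝓞 ℚ) ∉ v₀.asIdeal := natCast_not_mem_of_not_dvd hq₀ hv₀ hn2
  have hv₀W : W.HasGoodReductionAt v₀ := by
    obtain hpq := primesEquiv_eq hq₀ hv₀
    subst hpq
    exact (hasGoodReductionAtPrime_iff_hasGoodReductionAt_ringOfIntegers v₀ W).mp hgood₀
  have hram : closureEmb (K := ℚ) (v₀.adicCompletion ℚ) (geomSqrt ((d : ℤ) : ℚ)) ∉ maxUnramified (v₀.adicCompletion ℚ) := by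
    apply closureEmb_geomSqrt_not_mem_maxUnramified_rat v₀
    obtain ⟨m, hm⟩ := hq₀d
    have hqm : ¬ (q₀ : ℤ) ∣ m := fun hm' ↦ by
      have hsq : (q₀ : ℤ) * q₀ ∣ d := by rw [hm]; exact mul_dvd_mul_left _ hm'
      have hu := hsf _ hsq
      rw [Int.isUnit_iff] at hu
      rcases hu with hu | hu
      · exact hq₀.one_lt.ne' (by exact_mod_cast hu)
      · have : (0 : ℤ) ≤ (q₀ : ℤ) := by positivity
        omega
    rw [show ((d : ℤ) : ℚ) = ((q₀ : ℕ) : ℚ) * ((m : ℤ) : ℚ) by rw [hm]; push_cast; ring, Valuation.map_mul,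
      valuation_natCast_eq_exp_neg_one_of_mem v₀ hq₀ hv₀, valuation_intCast_eq_one_of_not_dvd (K := ℚ) (v := v₀) hq₀ hv₀ hqm,
      mul_one]
  have ht : Nat.card (nsmulAddMonoidHom 2 : (W.baseChange (v₀.adicCompletion ℚ)).toAffine.Point →+ _).ker = 2 :=
    natCard_ker_nsmul_adicCompletion_two_eq_two_of_jacobiSym W hq₀2 hgood₀ hq₀Δ' hjac hv₀
  -- the twist and the menus
  have hd0 : d ≠ 0 := hdneg.ne
  have hdQ : ((d : ℤ) : ℚ) ≠ 0 := by exact_mod_cast hd0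
  obtain ⟨φ, ψ, hψφ, hφψ, -⟩ := exists_intertwining_hsplit W hdQ hCd
  have hfin := GenusKolyTransp.transpAdmissible_place_menu W hd' hv₀ hCd φ ψ hψφ hφψ
  have hneg' : Wd.Δ < 0 := by
    rw [← hCd, variableChange_Δ, quadraticTwist_Δ]
    have hu : (0 : ℚ) < (↑Cd.u⁻¹ : ℚ) ^ 12 := Even.pow_pos (by decide) (Units.ne_zero _)
    have hd6 : (0 : ℚ) < ((d : ℤ) : ℚ) ^ 6 := Even.pow_pos (by decide) hdQ
    exact mul_neg_of_pos_of_neg hu (mul_neg_of_pos_of_neg hd6 hΔ)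
  have hinf : ∀ w : InfinitePlace ℚ,
      (∃ s : w.Completion, s ^ 2 = algebraMap ℚ w.Completion ((d : ℤ) : ℚ)) ∨
      ((∀ y : galoisCohomology (W.localGaloisModule w.Completion) 1, y = 0) ∧
        (∀ y : galoisCohomology (Wd.localGaloisModule w.Completion) 1, y = 0)) := fun w ↦
    Or.inr ⟨fun y ↦ GenusExact.ArchVanishing.localH1_infinitePlace_eq_zero_of_Δ_neg W w hΔ y,
      fun y ↦ GenusExact.ArchVanishing.localH1_infinitePlace_eq_zero_of_Δ_neg _ w hneg' y⟩
  obtain ⟨hup, hdown⟩ :=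
    GenusKolyTwistLocal.natCard_selmerGroup_twist_directed_of_menu_frame W Wd hdQ hCd v₀ h2v₀ hv₀W hram ht hfin hinf
  have hmem : ∀ c, c ∈ (W.kummerSelmerStructure ((2 : ℕ) : ℤ)).selmerGroup ↔ c ∈ W.selmerGroup ((2 : ℕ) : ℤ) := fun c ↦
    (SetLike.ext_iff.mp (W.selmerGroup_eq_selmerGroup_kummerSelmerStructure ((2 : ℕ) : ℤ)) c).symm
  refine ⟨fun hall ↦ hup fun c hc ↦ ?_, fun ⟨c, hc, hcn⟩ ↦ hdown ⟨c, (hmem c).mpr hc, fun h0 ↦ hcn ?_⟩⟩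
  · exact (mem_torsionLocalKer_iff_localization_eq_zero_rat W v₀ c).mp (hall c ((hmem c).mp hc))
  · exact (mem_torsionLocalKer_iff_localization_eq_zero_rat W v₀ c).mpr h0

/-! ## §2 On a `#Sel₂(E) = 4` cell -/

/-- **`#Sel₂(Wd) ∈ {2, 8}` on a `#Sel₂(E) = 4` cell** (`Δ_E < 0`, `(d, q₀)` transposition-admissible): `2` iff `ℓ₀`-narrow, `8` iff all of `Sel₂(E)` is
`ℓ₀`-trivial.  BSD is NOT proved by this. [cite: MazurRubin2010, Prop. 3.3] [cite: Kramer1981, Thm. 1] -/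
theorem natCard_selmerGroup_twin_eq_two_or_eq_eight (hΔ : W.Δ < 0) (h4 : Nat.card (W.selmerGroup 2) = 4)
    (hd : TranspAdmissible W d q₀) {v₀ : HeightOneSpectrum (𝓞 ℚ)} (hv₀ : (q₀ : 𝓞 ℚ) ∈ v₀.asIdeal)
    {Wd : WeierstrassCurve ℚ} [Wd.IsElliptic] (Cd : VariableChange ℚ) (hCd : Cd • W.quadraticTwist (d : ℚ) = Wd) :
    Nat.card (Wd.selmerGroup 2) = 2 ∨ Nat.card (Wd.selmerGroup 2) = 8 := by
  change Nat.card (Wd.selmerGroup ((2 : ℕ) : ℤ)) = 2 ∨ Nat.card (Wd.selmerGroup ((2 : ℕ) : ℤ)) = 8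
  have h4' : Nat.card (W.selmerGroup ((2 : ℕ) : ℤ)) = 4 := h4
  obtain ⟨hup, hdown⟩ := natCard_selmerGroup_twin_directed_of_transpAdmissible W hΔ hd hv₀ Cd hCd
  by_cases hall : ∀ c ∈ W.selmerGroup ((2 : ℕ) : ℤ), c ∈ W.torsionLocalKer (v₀.adicCompletion ℚ) ((2 : ℕ) : ℤ)
  · right
    have h := hup hall
    omega
  · left
    push Not at hall
    have h := hdown hall
    omega

/-- **`#Sel₂(Wd) = 2 ⟺ ℓ₀-NARROW** on a `#Sel₂(E) = 4` cell (`Δ_E < 0`, `(d, q₀)` transposition-admissible): the twin's Selmer group has order `2` iff SOME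
`2`-Selmer class of `E` is non-trivial at the door place `v₀` (both directions from §1 by counting).  For STUB N1: the frame's output clause
`#Sel₂(E^{(-ℓ₀)}) = 2` is exactly a Čebotarev condition on `ℓ₀` relative to `Sel₂(E)`.  BSD is NOT proved by this.
[cite: MazurRubin2010, Prop. 3.3, Lemma 2.2] [cite: Kramer1981, Prop. 3, Thm. 1] -/
theorem natCard_selmerGroup_twin_eq_two_iff_exists_not_doorTrivial (hΔ : W.Δ < 0) (h4 : Nat.card (W.selmerGroup 2) = 4)
    (hd : TranspAdmissible W d q₀) {v₀ : HeightOneSpectrum (𝓞 ℚ)} (hv₀ : (q₀ : 𝓞 ℚ) ∈ v₀.asIdeal)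
    {Wd : WeierstrassCurve ℚ} [Wd.IsElliptic] (Cd : VariableChange ℚ) (hCd : Cd • W.quadraticTwist (d : ℚ) = Wd) :
    Nat.card (Wd.selmerGroup 2) = 2 ↔ ∃ c ∈ W.selmerGroup 2, c ∉ W.torsionLocalKer (v₀.adicCompletion ℚ) 2 := by
  change Nat.card (Wd.selmerGroup ((2 : ℕ) : ℤ)) = 2 ↔
    ∃ c ∈ W.selmerGroup ((2 : ℕ) : ℤ), c ∉ W.torsionLocalKer (v₀.adicCompletion ℚ) ((2 : ℕ) : ℤ)
  have h4' : Nat.card (W.selmerGroup ((2 : ℕ) : ℤ)) = 4 := h4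
  obtain ⟨hup, hdown⟩ := natCard_selmerGroup_twin_directed_of_transpAdmissible W hΔ hd hv₀ Cd hCd
  refine ⟨fun hSel ↦ ?_, fun hnar ↦ ?_⟩
  · by_contra hno
    push Not at hno
    have h := hup hno
    omega
  · have h := hdown hnar
    omega

/-- **ALL OF `Sel₂(E)` IS `ℓ₀`-TRIVIAL ⟺ `#Sel₂(Wd) = 8`** on a `#Sel₂(E) = 4` cell (`Δ_E < 0`, `(d, q₀)` transposition-admissible) — the complementary
(non-narrow, «phantom-coincidence») branch, dead for socle selection.  BSD is NOT proved by this. [cite: MazurRubin2010, Prop. 3.3] [cite: Kramer1981, Thm. 1] -/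
theorem natCard_selmerGroup_twin_eq_eight_iff_forall_doorTrivial (hΔ : W.Δ < 0) (h4 : Nat.card (W.selmerGroup 2) = 4)
    (hd : TranspAdmissible W d q₀) {v₀ : HeightOneSpectrum (𝓞 ℚ)} (hv₀ : (q₀ : 𝓞 ℚ) ∈ v₀.asIdeal)
    {Wd : WeierstrassCurve ℚ} [Wd.IsElliptic] (Cd : VariableChange ℚ) (hCd : Cd • W.quadraticTwist (d : ℚ) = Wd) :
    Nat.card (Wd.selmerGroup 2) = 8 ↔ ∀ c ∈ W.selmerGroup 2, c ∈ W.torsionLocalKer (v₀.adicCompletion ℚ) 2 := by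
  constructor
  · intro h8 c hc
    by_contra hcn
    have h2 := (natCard_selmerGroup_twin_eq_two_iff_exists_not_doorTrivial W hΔ h4 hd hv₀ Cd hCd).mpr ⟨c, hc, hcn⟩
    omega
  · intro hall
    change Nat.card (Wd.selmerGroup ((2 : ℕ) : ℤ)) = 8
    change ∀ c ∈ W.selmerGroup ((2 : ℕ) : ℤ), c ∈ W.torsionLocalKer (v₀.adicCompletion ℚ) ((2 : ℕ) : ℤ) at hall
    have h4' : Nat.card (W.selmerGroup ((2 : ℕ) : ℤ)) = 4 := h4
    have h := (natCard_selmerGroup_twin_directed_of_transpAdmissible W hΔ hd hv₀ Cd hCd).1 hall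
    omega

end Summit.BirchSwinnertonDyer.BirchSwinnertonDyer.Theorems.GenusExact.PlusDescent.SocleSelection

end
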